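import Literature.NumberTheory.EllipticCurves.FineSelmerIsotypicClassGroupCriterion
import HarnessLib

/-!
# Deo–Ray–Sujatha 2023 Thm. 3.9 (b), class-number form — DISCHARGED
# (`thm39_fineSelmerDual_moduleFinite_of_classNumber_divisionField_holds`)

Topic `NumberTheory/EllipticCurves` (grouping namespace `DeoRaySujatha2023`).  `Proofs` file (theorems
only: no definition, no named fact, no `sorry`), written by the literature seat `bsd-potss-conjA-anchor`
g17 (cell `bsd-potss`; serves the asides stmt-BirchSwinnertonDyer-19386 / 19413).  It proves the named
Literature fact `DeoRaySujatha2023.thm39_fineSelmerDual_moduleFinite_of_classNumber_divisionField`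
(`FineSelmerClassGroupCriterion.lean`; consumers:
`Summits/…/Theorems/KatoDescentPotSupersingularWildFineSelmerClassGroupRoad.lean`,
`…/AdditiveBranchIMCGordTwoRankOneSmallImageClassNumberDickson.lean`,
`…/AdditiveBranchIMCGordTwoRankOneHeegnerKolyvaginSmallImageClassNumber.lean`):

> `E/ℚ` elliptic, `p` odd, `E[p]` irreducible, (c1) `p ∤ #Gal(ℚ(E[p])/ℚ)`, `p ∤ h(ℚ(E[p]))`,
> (c3) `E[p^∞]` has no non-zero `p`-torsion point fixed by `D_v` for `v = p` and the bad places
> ⟹ for the cyclotomic `ℤ_p`-extension, statement (A): the dual fine Selmer group is finitely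
> generated over `ℤ_p`.

The `_holds` theorem cannot be appended to the fact's own file (that file lies in the import cone of the
proof), so it lives here, as for `IwasawaTheory/Fukuda1994Thm1RankProofs.lean`.

PROOF (not the printed one — Deo–Ray–Sujatha go through Poitou–Tate and `H²(ℚ_S/L_∞, E[p]) = 0`; the
tree's road is `H²`-free): `p ∤ h(ℚ(E[p]))` and (c1) give, by the equivariant Iwasawa lemma along
`ℚ_n(E[p])` (door L6, `homTrivial_divisionField_cyclotomicTower_of_not_dvd_classNumber`, Washington
§13.3 / Thm. 10.4 made `E[p]`-isotypic), that the `E[p]`-part of `Cl(ℚ_n(E[p]))` is absent for every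
`n`; the isotypic Coates–Sujatha argument (`CoatesSujatha2005.conjA_of_homTrivial_cyclotomicTower`:
invariant fine-Selmer shadow ⟹ equivariant unramified descent ⟹ equivariant Artin reciprocity) turns this
into the finiteness of `Sel₀(ℚ_∞, E[p])`, which is (A) by Lim–Sujatha's lemma.  Hypotheses used: `p ≠ 2`,
(c1), `p ∤ h`, (c3) AT `p` ONLY, `κ` cyclotomic; irreducibility and (c3) at the bad places are not needed.

## References

* S. V. Deo, A. Ray, R. Sujatha, *On the μ equals zero conjecture for fine Selmer groups in Iwasawa
  theory*, Pure Appl. Math. Q. 19 (2023), §3 Thm. 3.8, Thm. 3.9 (b), Example 3.10; §5 Lemma 5.1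
  (arXiv:2202.09937 pp. 9–10, 17). [DeoRaySujatha2023]
* J. Coates, R. Sujatha, Math. Ann. 331 (2005), §3 Thm. 3.4, Lemma 3.8. [CoatesSujatha2005]
* L. C. Washington, *Introduction to Cyclotomic Fields*, 2nd ed. (1997), §13.3, Thm. 10.4. [Washington1997]
-/

noncomputable section

open scoped Classical
open NumberField Field IsDedekindDomain WeierstrassCurve
open Literature.NumberTheory.GaloisRepresentations Literature.NumberTheory.EllipticCurves

namespace Literature.NumberTheory.EllipticCurves.DeoRaySujatha2023

/-- **Deo–Ray–Sujatha 2023, Thm. 3.9 (b) with Lemma 5.1, class-number form — PROVED**: the named fact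
`thm39_fineSelmerDual_moduleFinite_of_classNumber_divisionField` holds.  `E/ℚ` elliptic, `p` odd,
(c1) `p ∤ #Gal(ℚ(E[p])/ℚ)`, `p ∤ h(ℚ(E[p]))`, (c3) at `p` (`E(ℚ_p)[p] = 0` in the `E[p^∞]`-currency), `κ`
cyclotomic ⟹ (A).  Proof: door L6 from the class number
(`homTrivial_divisionField_cyclotomicTower_of_not_dvd_classNumber`) and
`CoatesSujatha2005.conjA_of_homTrivial_cyclotomicTower` (the `H²`-free isotypic Coates–Sujatha argument);
`classNumber = Nat.card (ClassGroup)`.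
[cite: DeoRaySujatha2023, §3 Thm. 3.8, Thm. 3.9 (b) (arXiv:2202.09937 pp. 9–10) and §5 Lemma 5.1 (p. 17)]
[cite: CoatesSujatha2005, §3 Thm. 3.4 (proof) and Lemma 3.8]
[cite: Washington1997, §13.3 Lemmas 13.14–13.15 and Thm. 10.4 (proof)] -/
theorem thm39_fineSelmerDual_moduleFinite_of_classNumber_divisionField_holds :
    thm39_fineSelmerDual_moduleFinite_of_classNumber_divisionField := by
  intro W _ p _ hp2 _ hG hh hloc κ hκ
  have hp : p.Prime := Fact.out
  haveI : NeZero p := ⟨hp.ne_zero⟩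
  haveI : NumberField (W.divisionField p) := NumberField.mk
  have hh' : ¬ p ∣ Nat.card (ClassGroup (𝓞 (W.divisionField p))) := by
    rw [Nat.card_eq_fintype_card]
    exact hh
  exact CoatesSujatha2005.conjA_of_homTrivial_cyclotomicTower W hp2 hκ
    (homTrivial_divisionField_cyclotomicTower_of_not_dvd_classNumber W p hp2 hG hh' hκ
      (fun v hv => hloc v (Or.inl hv)))

end Literature.NumberTheory.EllipticCurves.DeoRaySujatha2023

end
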